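import Summits.HodgeConjecture.HodgeConjecture.Theorems.MarkmanPartnerTransportK3Sq2KugaSatakeMixedEndomorphisms
import Summits.HodgeConjecture.HodgeConjecture.Theorems.MarkmanPartnerTransportK3Sq2KugaSatakeOrphanKSVarescoFree
import Summits.HodgeConjecture.HodgeConjecture.Theorems.Ring2AbelianAllAndrePrimitiveProjectorAlgebraic

/-!
# Route MarkmanPartnerTransport · support `PartnerTransport` (stmt-HodgeConjecture-19650) ∕ crux #4 — programme
# «KS-MIXED», step M5: HC⁴(S × S) ⇒ HC⁴(X) ALONG A TRANSCENDENTAL HODGE SIMILITUDE `H²(S) → H²(X)`, GRANTED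
# KUGA–SATAKE ON BOTH SIDES (K3-type surface `S`, marked `K3^{[2]}`-type fourfold `X`)

`hodgeConjectureFor_of_square_of_kugaSatake_SX`: let `g : H²(S(ℂ); ℂ) → H²(X(ℂ); ℂ)` be rational, type-preserving,
with `q`-transcendental image, injective on `T(S)_ℂ`, onto `T(X)_ℂ`, `q(φ g y, φ g w) = μ ∫_S y ∪ w` (`μ ≠ 0`).
GRANTED `IsKSCorrespondenceAlgebraicBetti` for `S`, `IsKSCorrespondenceAlgebraicHK 2` for `X`, and the records
{Charles–Markman, Verbitsky–Guan, O'Grady}: `HodgeConjectureFor 4 (S ⊗ S) → HodgeConjectureFor 4 X`. Proof (Schur /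
subfield argument, no second Kuga–Satake instantiation):
1. `Φ : H²(S) → H²(X)` algebraic with `Φ = g` on `T(S)_ℂ` (`…MixedSimilitudeSX`); its restriction is the Hodge
   ISOMORPHISM `g_T : T(S)_ℚ ⥲ T(X)_ℚ`.
2. `R = ᵗΦ ∘ L² : H²(X) → H²(S)` (`exists_lefschetzTranspose_toSurface`) is algebraic with `(R ∘ Φ) σ ≠ 0`
   (Hodge–Riemann); rational descent of `R` gives a NON-ZERO Hodge morphism `b : T(X)_ℚ → T(S)_ℚ` induced by
   algebraic correspondences `X → S`.
3. For a route endomorphism `f` of `H²(X)` with restriction `f_T ∈ E(X) = End_Hdg T(X)_ℚ` (a FIELD, Zarhin):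
   `u := g_T ∘ b ∈ E(X)` is cycle-induced and non-zero, `e₂ := b ∘ f_T ∘ g_T ∈ E(S)` is cycle-induced by HC⁴(S × S)
   (`exists_corr_eq_of_mem_endAlg_of_hodgeConjectureFor_square`), so `c := g_T ∘ e₂ ∘ b = u ∘ f_T ∘ u = (u ∘ u) ∘ f_T`
   (commutativity of `E(X)`) is cycle-induced; the subfield trick gives `f_T` cycle-induced, i.e. `SpannedByCycle`.
4. `hodgeConjectureFor_of_spannedByCycleInduced_of_charlesMarkman` concludes HC⁴(X).

CONDITIONAL on the two Kuga–Satake hypotheses (open in print) and the three records; THEOREMS ONLY; no sorry, no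
definition, no new named fact; nothing here says HC or any item is proved unconditionally. Prover seat
hodge-nonav-19652-p1 (gen 16), `--supports stmt-HodgeConjecture-19650`.

References: M. Varesco, Math. Z. 305 (2023) §2 (p. 8), Cor. 4.6, Rem. 5.5; D. Huybrechts, Comment. Math. Helv. 94
(2019) Rem. 3.3; Yu. Zarhin, J. reine angew. Math. 341 (1983) Thm. 1.5.1; F. Charles, E. Markman, Compos. Math.
149 (2013) Thm. 1.1; W. Fulton, *Intersection Theory* §16.1.
-/

set_option linter.dupNamespace false

noncomputable section

namespace Summit.HodgeConjecture.HodgeConjecture.Theorems.MarkmanPartnerTransport.KugaSatakeMixed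

open scoped TensorProduct
open CategoryTheory MonoidalCategory Literature.AlgebraicGeometry Literature.AlgebraicGeometry.Motives
open Literature.AlgebraicGeometry.HodgeTheory Literature.AlgebraicTopology.SingularHomology
open Literature.AlgebraicGeometry.Motives.HodgeStructure Literature.AlgebraicGeometry.Hyperkaehler
open Literature.AlgebraicGeometry.Surfaces
open Summit.HodgeConjecture.HodgeConjecture.Ring2.AbelianAll
open Summit.HodgeConjecture.HodgeConjecture.Theorems.OddPrimeSquares
open Summit.HodgeConjecture.HodgeConjecture.Theorems.NikulinTwinTransport
open Summit.HodgeConjecture.HodgeConjecture.Theorems.MarkmanPartnerTransport.TranscendentalPresentation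
open Summit.HodgeConjecture.HodgeConjecture.Theorems.MarkmanPartnerTransport.KugaSatakeSelf
open Summit.HodgeConjecture.HodgeConjecture.Theorems.MarkmanPartnerTransport.KugaSatakePair
open Summit.HodgeConjecture.HodgeConjecture.Theorems.MarkmanPartnerTransport.KugaSatakeHK
open Summit.HodgeConjecture.HodgeConjecture.Theorems.MarkmanPartnerTransport.PartnerLattice

variable {S X : SchemeOver ℂ} {φ : complexBetti X 2 ≃ₗ[ℂ] (K3HilbertIndex → ℂ)} {PX : complexBetti X (2 * 4)}
  {z : K3HilbertIndex → ℂ}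

/-- `MarkedK3Sq[X, φ, P, z]`: VERBATIM the `let MarkedK3Sq := …` binder of the route declarations of
MarkmanPartnerTransport (clauses (m1)–(m6)). Local notation only. -/
local notation3 (prettyPrint := false) "MarkedK3Sq[" X ", " φ ", " P ", " z "]" =>
  (((IsIntegralClass P ∧ ∀ Q : complexBetti X (2 * 4), IsIntegralClass Q → ∃ n : ℤ, Q = n • P) ∧
    (∀ c : complexBetti X 2, IsIntegralClass c ↔ ∃ v : K3HilbertIndex → ℤ, φ c = fun i => (v i : ℂ)) ∧
    (∀ a : complexBetti X 2, cupPowTwo a 4 = ((3 : ℂ) * (k3HilbertForm 2 (φ a) (φ a)) ^ 2) • P) ∧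
    (IsOfHodgeType 4 X 2 2 0 (LinearEquiv.symm φ z) ∧
      ∀ τ : complexBetti X 2, IsOfHodgeType 4 X 2 2 0 τ → ∃ t : ℂ, τ = t • LinearEquiv.symm φ z) ∧
    (∀ c : complexBetti X 2, IsOfHodgeType 4 X 2 1 1 c ↔
      (k3HilbertForm 2 (φ c) z = 0 ∧ k3HilbertForm 2 (φ c) (star z) = 0)) ∧
    (k3HilbertForm 2 z z = 0 ∧ 0 < (k3HilbertForm 2 (star z) z).re)))

/-- `H²[hS]`: the weight-two `ℚ`-Hodge structure on `H²(S(ℂ); ℚ)` of the real Hodge model of the surface `S`. -/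
local notation3 "H²[" hS "]" =>
  bettiTwoHodgeStructure hS (BettiUniverse.realHodgeModel exists_isReal_hodgeModel_holds hS)
    (BettiUniverse.realHodgeModel_isHodgeSymmetric exists_isReal_hodgeModel_holds hS)

/-- `T[hS] = T(S)_ℚ = Hdg¹^⊥ ⊆ H²(S(ℂ); ℚ)`. -/
local notation3 "T[" hS "]" =>
  transcendentalLatticeBetti hS (BettiUniverse.realHodgeModel exists_isReal_hodgeModel_holds hS)
    (BettiUniverse.realHodgeModel_isHodgeSymmetric exists_isReal_hodgeModel_holds hS)

/-- `H²_B[hX]`: the weight-two `ℚ`-Hodge structure on `H²(X(ℂ); ℚ)` of the real Hodge model of the fourfold `X`. -/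
local notation3 "H²_B[" hX "]" =>
  bettiTwoHodgeStructureOfModel hX (BettiUniverse.realHodgeModel exists_isReal_hodgeModel_holds hX)
    (BettiUniverse.realHodgeModel_isHodgeSymmetric exists_isReal_hodgeModel_holds hX)

/-- `Θ : ℂ ⊗_ℚ H²(Y(ℂ); ℚ) → H²(Y(ℂ); ℂ)` (`Y = S` or `X`). -/
local notation3 "Θ[" Y "]" => ofRatClassBaseChange (Motives.ComplexPoints Y) (2 * 1)

/-- `ι : H²(Y(ℂ); ℚ) → H²(Y(ℂ); ℂ)`, the rational lattice. -/
local notation3 "ι[" Y "]" => ofRatClass (Motives.ComplexPoints Y) (2 * 1)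

/-- `Transc[S, y]`: `y` is cup-orthogonal to `N¹(S) = algebraicClasses S 1`. -/
local notation3 (prettyPrint := false) "Transc[" S ", " y "]" =>
  (∀ d ∈ algebraicClasses S 1, cupProduct (rfl : 2 * 1 + 2 * 1 = 2 * 2) y d = 0)

/-- `BBF[X, φ, y]`: `y` is `q`-orthogonal to `N¹(X) = algebraicClasses X 1`. -/
local notation3 (prettyPrint := false) "BBF[" X ", " φ ", " y "]" =>
  (∀ e : complexBetti X 2, e ∈ algebraicClasses X 1 → k3HilbertForm 2 (φ y) (φ e) = 0)

/-! ### The transport theorem -/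

set_option maxHeartbeats 400000 in
/-- **HC⁴(S × S) ⇒ HC⁴(X) along a transcendental Hodge similitude `H²(S) → H²(X)`, GRANTED KUGA–SATAKE for `S` and
`X`** (and Charles–Markman, Verbitsky–Guan, O'Grady). Data as in
`exists_algebraicCorrespondence_eq_of_similitude_of_kugaSatake_SX`. Proof: module docstring (Schur / subfield
argument). CONDITIONAL; credits nothing to the Hodge conjecture. [cite: Varesco2023, §2 (p. 8) and Cor. 4.6]
[cite: Huybrechts2019, Rem. 3.3] [cite: Zarhin1983HodgeGroupsK3, Thm. 1.5.1] [cite: CharlesMarkman2013, Thm. 1.1 (§1)] -/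
theorem hodgeConjectureFor_of_square_of_kugaSatake_SX
    (hV : VerbitskyGuan_cohomology_K3HilbertSquareType) (hO : OGrady2008_dualBBFClass_algebraic)
    (hCM : CharlesMarkman2013_lefschetzStandard_K3HilbertType)
    (hS : IsSmoothProjective 2 S) {σ : complexBetti S (2 * 1)} (hσ : IsOfHodgeType 2 S (2 * 1) 2 0 σ) (hσ0 : σ ≠ 0)
    (hline : ∀ c : complexBetti S (2 * 1), IsOfHodgeType 2 S (2 * 1) 2 0 c → ∃ t : ℂ, c = t • σ)
    (hX : IsSmoothProjective 4 X) (hK : IsOfK3HilbertSquareType X) (hM : MarkedK3Sq[X, φ, PX, z])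
    (hKS : IsKSCorrespondenceAlgebraicBetti hS) (hKSX : IsKSCorrespondenceAlgebraicHK 2 hX)
    (g : complexBetti S (2 * 1) →ₗ[ℂ] complexBetti X 2)
    (h1 : ∀ y, IsRationalClass y → IsRationalClass (g y))
    (h2 : ∀ (i j : ℕ) y, IsOfHodgeType 2 S (2 * 1) i j y → IsOfHodgeType 4 X 2 i j (g y))
    (h4 : ∀ y : complexBetti S (2 * 1), BBF[X, φ, g y])
    (hinj : ∀ y : complexBetti S (2 * 1), Transc[S, y] → g y = 0 → y = 0)
    (hsurj : ∀ y' : complexBetti X 2, BBF[X, φ, y'] → ∃ y, Transc[S, y] ∧ g y = y')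
    {μ : ℂ} (hμ : μ ≠ 0)
    (hmul : ∀ y w : complexBetti S (2 * 1), Transc[S, y] → Transc[S, w] →
      k3HilbertForm 2 (φ (g y)) (φ (g w)) = μ * traceC hS (cupProduct (rfl : 2 * 1 + 2 * 1 = 2 * 2) y w))
    (hHC : HodgeConjectureFor 4 (S ⊗ S)) : HodgeConjectureFor 4 X := by
  classical
  have hX2 : IsSmoothProjective (2 * 2) X := hX
  haveI := BettiUniverse.finite hS (2 * 1); haveI := BettiUniverse.finite hX2 (2 * 1)
  -- the presentations and `g_T`
  obtain ⟨T, P, ε, hT, htrS, hirr, hK3, -⟩ := exists_isTranscendentalPartBetti_trPart hS hσ hσ0 hline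
  obtain ⟨b, T', Pol, -, hbq, hirr', hK3T', htr', -, hj'⟩ := exists_isTranscendentalPartHK hX2 hM
  haveI := Module.Finite.of_injective T.toSubmodule.subtype T.toSubmodule.injective_subtype
  haveI := Module.Finite.of_injective T'.toSubmodule.subtype T'.toSubmodule.injective_subtype
  have hT' := mem_toSubmodule_iff_of_isTranscendentalPartHK hX2 hbq hj'
  obtain ⟨gT, hgT⟩ := exists_hom_transcendental_SX hS hX2 T T' hT' g h1 h2 h4
  have hbij : Function.Bijective gT.toLinearMap := hom_transcendental_bijective_SX hT hT' hgT hinj hsurj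
  -- step 1: `Φ` algebraic `S → X`, `= g` on `T(S)_ℂ`
  obtain ⟨Φ, hΦ, hΦg⟩ := exists_algebraicCorrespondence_eq_of_similitude_of_kugaSatake_SX hCM hS hσ hσ0 hline hX2 hK
    hM hKS hKSX g h1 h2 h4 hinj hsurj hμ hmul
  have hΦt : ∀ t : T.toSubmodule, Φ (ι[S] (t : bettiCohomology S (2 * 1))) =
      ι[X] ((gT.toLinearMap t : T'.toSubmodule) : bettiCohomology X (2 * 1)) := fun t => by
    rw [hΦg _ ((mem_transcendental_iff_transc hS _).1 (hT ▸ t.2)), hgT]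
  -- step 2: the Lefschetz–transpose `R : H²(X) → H²(S)` of `Φ`, non-vanishing at the period
  obtain ⟨R, hRid, hRΦ, hne⟩ := exists_lefschetzTranspose_toSurface hS hX (by norm_num : 2 ≤ 4) hX
    (isAlgebraicCorrespondence_id hX (a := 2 * 1) (by norm_num)) hΦ
  have hR : IsAlgebraicCorrespondence 2 4 S X R := by simpa only [LinearMap.comp_id] using hRid
  have hσtr := transc_of_twoZero hS hσ
  obtain ⟨Ψg, hΨg⟩ := exists_ratLinear_ofRatClass_eq₂ (S' := X) g h1
  have hRΦσ : (R ∘ₗ Φ) σ ≠ 0 := by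
    refine hne σ (by rw [hΦg σ hσtr]; exact h2 _ _ _ hσ) (by rw [hΦg σ hσtr]; exact fun h0 => hσ0 (hinj σ hσtr h0)) ?_
    rw [hΦg σ hσtr, hΦg _ (transc_of_zeroTwo hS ((isOfHodgeType_conjClass_iff hS σ).2 hσ)),
      apply_conjClass_SX hS hX2 hΨg]
  -- a rational vector `t₀ ∈ T` with `R (Φ t₀) ≠ 0`
  obtain ⟨x₀, hx₀⟩ := exists_baseChange_eq_of_transc hS T hT hσtr
  have hzero_or : ∃ t₀ : T.toSubmodule, R (Φ (ι[S] (t₀ : bettiCohomology S (2 * 1)))) ≠ 0 := by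
    by_contra hall
    push Not at hall
    have hzero : ∀ x : ℂ ⊗[ℚ] T.toSubmodule, R (Φ (Θ[S] (T.toSubmodule.subtype.baseChange ℂ x))) = 0 := by
      intro x
      induction x using TensorProduct.induction_on with
      | zero => rw [map_zero, map_zero, map_zero, map_zero]
      | tmul c t =>
        rw [LinearMap.baseChange_tmul, Submodule.subtype_apply, ofRatClassBaseChange_tmul, map_smul, map_smul, hall t,
          smul_zero]
      | add x y hx hy => rw [map_add, map_add, map_add, map_add, hx, hy, add_zero]
    exact hRΦσ (by rw [LinearMap.comp_apply, ← hx₀]; exact hzero x₀)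
  obtain ⟨t₀, ht₀⟩ := hzero_or
  -- the cycle-induced Hodge endomorphisms of `T'` (self-correspondences of `X`)
  let Rs : Submodule ℚ (Module.End ℚ T'.toSubmodule) :=
    { carrier := {a | a ∈ T'.toHodgeStructure.endAlg ∧
        ∃ f : complexBetti X 2 →ₗ[ℂ] complexBetti X 2, IsAlgebraicCorrespondence 4 4 X X f ∧
          ∀ t : T'.toSubmodule, f (ι[X] (t : bettiCohomology X (2 * 1))) =
            ι[X] ((a t : T'.toSubmodule) : bettiCohomology X (2 * 1))}
      add_mem' := by
        rintro a a' ⟨haE, f, hf, hfa⟩ ⟨hbE, f', hf', hfb⟩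
        refine ⟨add_mem haE hbE, f + f', IsAlgebraicCorrespondence.add hX hX hf hf', fun t => ?_⟩
        rw [LinearMap.add_apply, hfa, hfb, LinearMap.add_apply, Submodule.coe_add, map_add]
      zero_mem' := by
        refine ⟨zero_mem _, 0, isAlgebraicCorrespondence_zero hX hX (e := 4) rfl (by norm_num), fun t => ?_⟩
        rw [LinearMap.zero_apply, LinearMap.zero_apply, Submodule.coe_zero, map_zero]
      smul_mem' := by
        rintro c a ⟨haE, f, hf, hfa⟩
        refine ⟨Subalgebra.smul_mem _ haE c, (c : ℂ) • f, IsAlgebraicCorrespondence.smul hX hX hf _, fun t => ?_⟩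
        rw [LinearMap.smul_apply, hfa, LinearMap.smul_apply, Submodule.coe_smul, Motives.ofRatClass_smul] }
  have hRsE : ∀ a ∈ Rs, a ∈ T'.toHodgeStructure.endAlg := fun a ha => ha.1
  have hRsmul : ∀ a ∈ Rs, ∀ a' ∈ Rs, a * a' ∈ Rs := by
    rintro a ⟨haE, f, hf, hfa⟩ a' ⟨hbE, f', hf', hfb⟩
    refine ⟨mul_mem haE hbE, f ∘ₗ f', IsAlgebraicCorrespondence.comp hX hX hX hf' hf (by norm_num), fun t => ?_⟩
    rw [LinearMap.comp_apply, hfb, hfa, Module.End.mul_apply]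
  -- rational descent of `R` to a Hodge morphism `bT : T' → T` induced by correspondences `X → S`, `bT (g_T t₀) ≠ 0`
  let Θe : (ℂ ⊗[ℚ] bettiCohomology S (2 * 1)) ≃ₗ[ℂ] complexBetti S (2 * 1) :=
    LinearEquiv.ofBijective (Θ[S]) ⟨ofRatClassBaseChange_injective _ _, ofRatClassBaseChange_surjective hS (2 * 1)⟩
  have hΘe : ∀ x, Θe x = Θ[S] x := fun _ => rfl
  have hΘe_symm : ∀ (c : ℂ) (w : bettiCohomology S (2 * 1)), Θe.symm (c • ι[S] w) = c ⊗ₜ[ℚ] w := by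
    intro c w
    apply Θe.injective
    rw [LinearEquiv.apply_symm_apply, hΘe, ofRatClassBaseChange_tmul]
  have hdescX : ∀ (r : ℂ →ₗ[ℚ] ℚ) {f : complexBetti X 2 →ₗ[ℂ] complexBetti S (2 * 1)},
      IsAlgebraicCorrespondence 2 4 S X f → ∃ (a : Hom T'.toHodgeStructure T.toHodgeStructure)
        (fa : complexBetti X 2 →ₗ[ℂ] complexBetti S (2 * 1)), IsAlgebraicCorrespondence 2 4 S X fa ∧
        (∀ t : T'.toSubmodule, fa (ι[X] (t : bettiCohomology X (2 * 1))) =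
          ι[S] ((a.toLinearMap t : T.toSubmodule) : bettiCohomology S (2 * 1))) ∧
        ∀ t : T'.toSubmodule,
          TensorProduct.lid ℚ _ (r.rTensor _ (Θe.symm (f (ι[X] (t : bettiCohomology X (2 * 1)))))) =
            ((a.toLinearMap t : T.toSubmodule) : bettiCohomology S (2 * 1)) := by
    intro r f hf
    obtain ⟨e, hab, γ, hγ, rfl⟩ := IsAlgebraicCorrespondence.exists_eq_corrAction hS hX hf
    suffices hc : ∀ c : ℂ, ∃ (a : Hom T'.toHodgeStructure T.toHodgeStructure)
        (fa : complexBetti X 2 →ₗ[ℂ] complexBetti S (2 * 1)), IsAlgebraicCorrespondence 2 4 S X fa ∧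
        (∀ t : T'.toSubmodule, fa (ι[X] (t : bettiCohomology X (2 * 1))) =
          ι[S] ((a.toLinearMap t : T.toSubmodule) : bettiCohomology S (2 * 1))) ∧
        ∀ t : T'.toSubmodule, TensorProduct.lid ℚ _ (r.rTensor _ (Θe.symm
          (c • corrAction complexOrientationFamily hS hX hab γ (ι[X] (t : bettiCohomology X (2 * 1)))))) =
          ((a.toLinearMap t : T.toSubmodule) : bettiCohomology S (2 * 1)) by
      obtain ⟨a, fa, hfa, hfat, hc1⟩ := hc 1
      exact ⟨a, fa, hfa, hfat, fun t => by rw [← hc1 t, one_smul]⟩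
    have hγ' := (le_of_eq (supportedClasses_eq_span_isRationalClass (hS.tensor_holds hX) (2 * e) e)) hγ
    clear hf hγ
    induction hγ' using Submodule.span_induction with
    | mem γ hγQ =>
      intro c
      obtain ⟨a, ha⟩ := exists_homAlg_of_isRationalClass_XS hS hX2 T' hirr' hK3T' T htrS hab hγQ.2 hγQ.1
      refine ⟨(r c) • a, ((r c : ℚ) : ℂ) • corrAction complexOrientationFamily hS hX hab γ,
        IsAlgebraicCorrespondence.smul hS hX (isAlgebraicCorrespondence_corrAction_complex hS hX hab (by norm_num) hγQ.2) _,
        fun t => ?_, fun t => ?_⟩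
      · rw [LinearMap.smul_apply, ha t, Hom.smul_toLinearMap, LinearMap.smul_apply, Submodule.coe_smul,
          Motives.ofRatClass_smul]
      · rw [ha t, hΘe_symm, lid_rTensor_tmul, Hom.smul_toLinearMap, LinearMap.smul_apply, Submodule.coe_smul]
    | zero =>
      intro c
      refine ⟨0, 0, isAlgebraicCorrespondence_zero hS hX (e := 4) rfl (by norm_num), fun t => ?_, fun t => ?_⟩
      · rw [LinearMap.zero_apply, Hom.zero_toLinearMap, LinearMap.zero_apply, Submodule.coe_zero, map_zero]
      · rw [map_zero, LinearMap.zero_apply, smul_zero, map_zero, map_zero, map_zero, Hom.zero_toLinearMap,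
          LinearMap.zero_apply, Submodule.coe_zero]
    | add γ γ' _ _ h₁ h₂ =>
      intro c
      obtain ⟨a, fa, hfa, hfat, hat⟩ := h₁ c
      obtain ⟨a', fa', hfa', hfat', hat'⟩ := h₂ c
      refine ⟨a + a', fa + fa', IsAlgebraicCorrespondence.add hS hX hfa hfa', fun t => ?_, fun t => ?_⟩
      · rw [LinearMap.add_apply, hfat, hfat', Hom.add_toLinearMap, LinearMap.add_apply, Submodule.coe_add, map_add]
      · rw [map_add, LinearMap.add_apply, smul_add, map_add, map_add, map_add, hat, hat', Hom.add_toLinearMap,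
          LinearMap.add_apply, Submodule.coe_add]
    | smul c' γ _ h₁ =>
      intro c
      obtain ⟨a, fa, hfa, hfat, hat⟩ := h₁ (c * c')
      refine ⟨a, fa, hfa, hfat, fun t => ?_⟩
      rw [(corrAction complexOrientationFamily hS hX hab).map_smul, LinearMap.smul_apply, smul_smul]
      exact hat t
  have hξ : Θe.symm (R (ι[X] ((gT.toLinearMap t₀ : T'.toSubmodule) : bettiCohomology X (2 * 1)))) ≠ 0 := fun h0 =>
    ht₀ (by rw [hΦt]; simpa only [LinearEquiv.apply_symm_apply, map_zero] using congrArg Θe h0)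
  obtain ⟨r, hr⟩ := exists_rat_retraction_ne_zero hξ
  obtain ⟨bT, fb, hfb, hfbt, hbr⟩ := hdescX r hR
  have hbT0 : bT.toLinearMap ≠ 0 := fun h0 => hr (by rw [hbr, h0, LinearMap.zero_apply, Submodule.coe_zero])
  have hbinj : Function.Injective bT.toLinearMap := Hom.injective_of_ne_zero_of_isIrreducible hirr' bT hbT0
  -- `u = g_T ∘ bT ∈ E(X)`, cycle-induced (`Φ ∘ fb`) and injective
  set u : Hom T'.toHodgeStructure T'.toHodgeStructure := gT.comp bT with hu
  have huR : u.toLinearMap ∈ Rs := by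
    refine ⟨Hom.toLinearMap_mem_endAlg u, Φ ∘ₗ fb, IsAlgebraicCorrespondence.comp hX hS hX hfb hΦ (by norm_num),
      fun t => ?_⟩
    rw [LinearMap.comp_apply, hfbt, hΦt]
    rfl
  have huinj : Function.Injective u.toLinearMap := hbij.1.comp hbinj
  -- the fields `E(S)`, `E(X)` (Zarhin)
  obtain ⟨hFieldX, -⟩ := Zarhin1983_endAlg_isField_holds T'.toHodgeStructure hirr' hK3T'
  -- step 3–4: every route endomorphism of `H²(X)` is cycle-induced on `T(X)`
  refine hodgeConjectureFor_of_spannedByCycleInduced_of_charlesMarkman hV hO hCM hX hK hM ?_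
  intro f hf1 hf2 hf3 hf4
  obtain ⟨fT, hfT⟩ := exists_hom_transcendentalHK hX2 T' hT' f hf1 hf2 hf4
  -- `e₂ = bT ∘ f_T ∘ g_T ∈ E(S)` is cycle-induced by HC⁴(S × S)
  obtain ⟨W, hW, hWt⟩ := exists_corr_eq_of_mem_endAlg_of_hodgeConjectureFor_square hS hσ hσ0 hline htrS hHC
    (Hom.toLinearMap_mem_endAlg (bT.comp (fT.comp gT)))
  -- `c = g_T ∘ e₂ ∘ bT = u ∘ f_T ∘ u` is cycle-induced (`Φ ∘ W ∘ fb`)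
  have hcR : (u.comp (fT.comp u)).toLinearMap ∈ Rs := by
    refine ⟨Hom.toLinearMap_mem_endAlg _, Φ ∘ₗ (W ∘ₗ fb),
      IsAlgebraicCorrespondence.comp hX hS hX (IsAlgebraicCorrespondence.comp hS hS hX hfb hW (by norm_num)) hΦ
        (by norm_num), fun t => ?_⟩
    rw [LinearMap.comp_apply, LinearMap.comp_apply, hfbt, hWt, hΦt]
    rfl
  -- commutativity of `E(X)`: `u ∘ f_T = f_T ∘ u`, so `(u ∘ u) ∘ f_T = u ∘ f_T ∘ u`
  have hcomm : u.toLinearMap * fT.toLinearMap = fT.toLinearMap * u.toLinearMap := by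
    have h := hFieldX.mul_comm ⟨u.toLinearMap, Hom.toLinearMap_mem_endAlg u⟩ ⟨fT.toLinearMap, Hom.toLinearMap_mem_endAlg fT⟩
    exact congrArg Subtype.val h
  have hrel : (u.toLinearMap * u.toLinearMap) * fT.toLinearMap = (u.comp (fT.comp u)).toLinearMap := by
    rw [mul_assoc, hcomm, ← mul_assoc]
    rfl
  -- the subfield trick: `f_T ∈ Rs`
  have hfTR : fT.toLinearMap ∈ Rs := by
    by_cases hf0 : fT.toLinearMap = 0
    · rw [hf0]; exact Rs.zero_mem
    · have hfinj : Function.Injective fT.toLinearMap := Hom.injective_of_ne_zero_of_isIrreducible hirr' fT hf0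
      have hc0 : (u.comp (fT.comp u)).toLinearMap ≠ 0 := by
        intro h0
        have hinj3 : Function.Injective (u.comp (fT.comp u)).toLinearMap := huinj.comp (hfinj.comp huinj)
        obtain ⟨t, ht⟩ := (Submodule.ne_bot_iff _).1 (Submodule.nontrivial_iff_ne_bot.1 hirr'.1)
        exact ht.2 (congrArg Subtype.val (hinj3 (a₁ := ⟨t, ht.1⟩) (a₂ := 0) (by rw [h0, map_zero, LinearMap.zero_apply])))
      exact mem_of_mul_eq_of_isField hFieldX Rs hRsE hRsmul hcR (hRsmul _ huR _ huR) (Hom.toLinearMap_mem_endAlg fT)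
        hc0 hrel
  obtain ⟨-, F, hF, hFt⟩ := hfTR
  -- `F = f` on `T(X)_ℂ`
  have hFy : ∀ y : complexBetti X 2, BBF[X, φ, y] → F y = f y := by
    intro y hy
    obtain ⟨x, rfl⟩ := exists_baseChange_eq_of_bbfTransc hX2 hM T' hT' hy
    clear hy
    induction x using TensorProduct.induction_on with
    | zero => rw [map_zero, map_zero, map_zero, map_zero]
    | tmul c t =>
      rw [LinearMap.baseChange_tmul, Submodule.subtype_apply, ofRatClassBaseChange_tmul, map_smul, map_smul, hFt t, hfT t]
    | add x y hx hy => rw [map_add, map_add, map_add, map_add, hx, hy]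
  -- the cycle form, with a RATIONAL class
  obtain ⟨e, hab, Z, hZ, hFZ⟩ := IsAlgebraicCorrespondence.exists_eq_corrAction hX hX hF
  obtain rfl : e = 4 := by omega
  obtain ⟨Z', hZ', hZ'Q, hZ'f⟩ := OrphanKS.exists_rational_corrAction_eq_on_bbfTransc hX hM f hf1 hZ
    (fun y hy => by rw [← hFy y hy, hFZ])
  have hXX : IsSmoothProjective (4 + 4) (X ⊗ X) := hX.tensor_holds hX
  refine ⟨1, fun _ => 1, fun _ => corrAction complexOrientationFamily hX hX (rfl : 2 + 2 * 4 = 2 + 2 * 4) Z',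
    fun _ => ⟨fun y hy => Arapura2006.isRationalClass_corrAction_complex hX hX _ hZ'Q hy, fun a c y hy => ?_,
      Z', hZ', fun y => rfl⟩, fun y hy => ?_⟩
  · exact Arapura2006.isOfHodgeType_corrAction_complex hX hX _
      (isOfHodgeType_of_mem_algebraicClasses_of_isSmoothProjective hXX 4 hZ') (by omega) (by omega) hy
  · rw [Fin.sum_univ_one, Rat.cast_one, one_smul, hZ'f y hy]

end Summit.HodgeConjecture.HodgeConjecture.Theorems.MarkmanPartnerTransport.KugaSatakeMixed

end
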